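import Literature.AlgebraicGeometry.ComplexMultiplication.ShimuraIsogenyBetti
import HarnessLib

/-!
# Type inflation transported to coded fields (kernel; consumer = the model-construction cell's `Fact_cmInflation`)

KERNEL corollary of `Shimura1998_Thm3_inflation` (a THEOREM under the four named hypotheses of
`ShimuraInflation.thm3_inflation_of`) in the exact shape the model universe consumes: the CM fields `K ⊆ M`
(through `k`) are replaced by isomorphic "code" fields `e₁ : K ≃ E₁`, `e₂ : M ≃ E₂` carrying the transported types
`Φ₁` (`τ ∈ Φ₁ ↔ τ ∘ e₁ ∈ Φ`) and `Φ₂` (`τ ∈ Φ₂ ↔ τ ∘ e₂ ∘ k ∈ Φ`, i.e. the transport of the induced type `Φ^M`),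
the realisations are realisations of `(E₁; Φ₁)` and `(E₂; Φ₂)`, and the CM actions are read back on `K` and `M`
through `e₁`, `e₂` (`cmAction (θ ∘ e₁)`, `cmAction (θ′ ∘ e₂)`).  PROVED: `Shimura1998_Thm3_inflation.rational_transport`
(the induced type of `Φ₁` along `k₀ := e₂ ∘ k ∘ e₁⁻¹ : E₁ → E₂` IS `Φ₂`; then `.rational` at `k₀` and
`cmAction_comp_ringEquiv`).  No new facts.
-/

noncomputable section

open NumberField CategoryTheory Module

namespace Literature.AlgebraicGeometry.ComplexMultiplication

open Literature.AlgebraicGeometry.Motives (SchemeOver IsSmoothProjective CMType AbelianVariety bettiCohomology)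
open Literature.AlgebraicGeometry.HodgeTheory (complexBetti IsOfHodgeType)
open Literature.AlgebraicGeometry.HodgeTheory.BettiUniverse (pull cmAction IsInducedOnIntegers)
open Literature.NumberTheory.ComplexMultiplication (inducedCMType mem_inducedCMType_iff)

/-- KERNEL: the type induced along `e₂ ∘ k ∘ e₁⁻¹` from the `e₁`-transport of `Φ` is the `e₂`-transport of the
type induced along `k`. [folklore] -/
theorem inducedCMType_transport {K M E₁ E₂ : Type} [Field K] [Field M] [Field E₁] [Field E₂]
    (k : K →+* M) (Φ : CMType K) (e₁ : K ≃+* E₁) (e₂ : M ≃+* E₂) {Φ₁ : CMType E₁} {Φ₂ : CMType E₂}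
    (hΦ₁ : ∀ τ : E₁ →+* ℂ, τ ∈ Φ₁.1 ↔ τ.comp e₁.toRingHom ∈ Φ.1)
    (hΦ₂ : ∀ τ : E₂ →+* ℂ, τ ∈ Φ₂.1 ↔ (τ.comp e₂.toRingHom).comp k ∈ Φ.1) :
    inducedCMType (e₂.toRingHom.comp (k.comp e₁.symm.toRingHom)) Φ₁ = Φ₂ := by
  apply Subtype.ext
  ext τ
  rw [mem_inducedCMType_iff, hΦ₁, hΦ₂]
  have hc : (τ.comp (e₂.toRingHom.comp (k.comp e₁.symm.toRingHom))).comp e₁.toRingHom =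
      (τ.comp e₂.toRingHom).comp k := by
    ext x
    simp
  rw [hc]

/-- KERNEL: **type inflation on coded fields, read on the rational CM actions.**  For `k : K → M`, `Φ` a CM type of
`K`, code fields `e₁ : K ≃ E₁`, `e₂ : M ≃ E₂` with transported types `Φ₁`, `Φ₂` (`Φ₂` = transport of the induced
type), a realisation `(A, ι, θ)` of `(E₁; Φ₁)` and a realisation `(A′, ι′, θ′)` of `(E₂; Φ₂)`: there are scheme
morphisms `p_j : A′ → A` with `⊕_j p_j^*` bijective on `H¹(−, ℚ)` and
`p_j^* ∘ cmAction (θ ∘ e₁) (a) = cmAction (θ′ ∘ e₂) (k a) ∘ p_j^*` for all `a ∈ K`. [folklore] -/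
theorem Shimura1998_Thm3_inflation.rational_transport (h38 : Shimura1998_Thm3_inflation)
    {K M E₁ E₂ : Type} [Field K] [NumberField K] [Field M] [NumberField M]
    [Field E₁] [NumberField E₁] [IsCMField E₁] [Field E₂] [NumberField E₂] [IsCMField E₂]
    (k : K →+* M) (Φ : CMType K) (e₁ : K ≃+* E₁) (e₂ : M ≃+* E₂) {Φ₁ : CMType E₁} {Φ₂ : CMType E₂}
    (hΦ₁ : ∀ τ : E₁ →+* ℂ, τ ∈ Φ₁.1 ↔ τ.comp e₁.toRingHom ∈ Φ.1)
    (hΦ₂ : ∀ τ : E₂ →+* ℂ, τ ∈ Φ₂.1 ↔ (τ.comp e₂.toRingHom).comp k ∈ Φ.1)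
    {A : AbelianVariety ℂ} {ι : 𝓞 E₁ →+* End A} {θ : E₁ →+* Module.End ℂ (complexBetti A.X 1)}
    {A' : AbelianVariety ℂ} {ι' : 𝓞 E₂ →+* End A'} {θ' : E₂ →+* Module.End ℂ (complexBetti A'.X 1)}
    (h : IsCMTypeRealisation Φ₁ A ι θ) (h' : IsCMTypeRealisation Φ₂ A' ι' θ')
    (hθ : IsInducedOnIntegers (θ.comp e₁.toRingHom)) (hθ' : IsInducedOnIntegers (θ'.comp e₂.toRingHom)) :
    ∃ (m : ℕ) (p : Fin m → (A'.X ⟶ A.X)),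
      Function.Bijective
        (∑ j : Fin m, pull (p j) 1 ∘ₗ LinearMap.proj j :
          (Fin m → bettiCohomology A.X 1) →ₗ[ℚ] bettiCohomology A'.X 1) ∧
      ∀ (j : Fin m) (a : K),
        pull (p j) 1 ∘ₗ (cmAction (θ.comp e₁.toRingHom) hθ a : Module.End ℚ (bettiCohomology A.X 1)) =
          (cmAction (θ'.comp e₂.toRingHom) hθ' (k a) : Module.End ℚ (bettiCohomology A'.X 1)) ∘ₗ
            pull (p j) 1 := by
  set k₀ : E₁ →+* E₂ := e₂.toRingHom.comp (k.comp e₁.symm.toRingHom) with hk₀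
  have hind : inducedCMType k₀ Φ₁ = Φ₂ := inducedCMType_transport k Φ e₁ e₂ hΦ₁ hΦ₂
  have h'' : IsCMTypeRealisation (inducedCMType k₀ Φ₁) A' ι' θ' := by rw [hind]; exact h'
  obtain ⟨m, p, hbij, hcomm⟩ :=
    h38.rational k₀ Φ₁ h h'' h.isInducedOnIntegers h'.isInducedOnIntegers
  refine ⟨m, p, hbij, fun j a ↦ ?_⟩
  have hk : e₂ (k a) = k₀ (e₁ a) := by simp [hk₀]
  rw [cmAction_comp_ringEquiv θ h.isInducedOnIntegers e₁ hθ a,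
    cmAction_comp_ringEquiv θ' h'.isInducedOnIntegers e₂ hθ' (k a), hk]
  exact hcomm j (e₁ a)

end Literature.AlgebraicGeometry.ComplexMultiplication

end
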